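import Summits.Ventures.QEC.Census.CertCheckBZBridge
import HarnessLib

/-!
# Brouwer–Zimmermann enumeration with an allow LIST: «every non-zero codeword of weight ≤ wmax is listed»
# (CERT-FORMAT L5 without labels; the level-2 / coset steps of the cover reduction, director R29 «ε lane»)

The `bz` branch of the checker (`Census/CertCheckBZ.lean`, soundness `Census/CertCheckBZSound.lean`) uses the
Brouwer–Zimmermann bound to conclude that every LOW-WEIGHT codeword of a block code is an allow-listed STABILIZER
(`block_sound`: the allow-list is decomposed over the stabilizer rows by `foundOK`, and the conclusion is about non-trivial
logicals via the label machinery L1). The cover reduction for `[[288,12,18]]` (qec-search-9, census/search-9/cover/README.md,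
director-qec R29) needs the same enumeration with a WEAKER, label-free conclusion: for a code given by ANY row list `Gb`
(e.g. the row space of `H^Z₇₂`, or a punctured coset code `span(res y₀, res G′)`), if `blockOK n wmax target allow Gb b`
passes (type-10's Bool check, unchanged: every matrix systematic on its information set, the replay `scan (bzLeaf …)`, the
recounted relative-rank bound `≥ target`) and `wmax < target`, then EVERY non-zero `c ∈ rowspace Gb` of weight `≤ wmax`
is `ofBits n w` for some LISTED word `w ∈ allow` — i.e. the allow-list is COMPLETE for weight `≤ wmax`. No `foundOK`, no
labels, no CSS structure.

* `henum_list_of_matrixOK` — the per-matrix enumeration verdict in list form (the proof of `henum_of_matrixOK` up to its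
  last step): a selection of `1 … t` rows of `G_i` whose codeword has weight `≤ wmax` gives an allow-listed word;
* `bz_list_sound` — the block statement above, by type-07's generic `bz_enumeration_span`
  (`Literature/InformationTheory/Coding/BrouwerZimmermannBound.lean`, predicate `P c := ∃ w ∈ allow, ofBits n w = c`) with
  the plumbing of `CertCheckBZBridge` (`hsys_of_systematicOK`, `rowFun_giRows_mem`, `bzBoundList_eq_bzBound`).
Control: the `[7,4]` Hamming code's 7 weight-3 words are exactly the listed ones (one block, two information sets, `decide`).
Engine-agnostic as usual: any lane that proves `matrixOK`'s `scan … = true` conjunct (`CertBZChunks.matrixEnumOK_of_reaches`,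
type-01's `CertBZPlane*`) feeds it. Tier KERNEL, axioms standard, no `native_decide`; no certificate data here.
-/

namespace Summit.Ventures.QEC.Census

open Matrix Finset Literature.InformationTheory.QuantumCodes Literature.InformationTheory.Coding

section List

variable {n : ℕ}

/-- **The enumeration verdict, list form**: if `matrixOK n wmax allow Gb mt` passes, every selection `a` of
`1 ≤ |a| ≤ t` rows of `G_i = A_i · G_b` whose codeword has weight `≤ wmax` yields an allow-LISTED word equal to that
codeword (the scan reached the support list of `a`; the selection word is non-zero; the fast weight test cannot have fired). -/
theorem henum_list_of_matrixOK {wmax : ℕ} {allow Gb : List ℕ} {mt : BZMatrix}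
    (hmt : matrixOK n wmax allow Gb mt = true) {kb : ℕ} (hk : (giRows Gb mt).length = kb) (a : Fin kb → ZMod 2)
    (ha1 : 1 ≤ hammingNorm a) (hat : hammingNorm a ≤ mt.t)
    (haw : hammingNorm (∑ j, a j • rowFun n (giRows Gb mt) kb j) ≤ wmax) :
    ∃ w ∈ allow, ofBits n w = ∑ j, a j • rowFun n (giRows Gb mt) kb j := by
  subst hk
  simp only [matrixOK, Bool.and_eq_true, List.all_eq_true, decide_eq_true_eq] at hmt
  obtain ⟨⟨-, hlt⟩, hscan⟩ := hmt
  have hreach := reaches_of_scan hscan (rowSupp (giRows Gb mt) a) (rowSupp_sublist _ a)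
    (by rw [length_rowSupp]; exact hat)
  rw [Nat.zero_xor, Nat.zero_xor, bzLeaf] at hreach
  have hsum : ∑ j, a j • rowFun n (giRows Gb mt) (giRows Gb mt).length j =
      ofBits n (xorSnd (rowSupp (giRows Gb mt) a)) := by
    rw [ofBits_xorSnd_rowSupp, ← sum_smul_rowMatrix_eq_vecMul]
    refine Finset.sum_congr rfl fun j _ => ?_
    congr 1
    funext q
    simp only [rowFun, rowMatrix, Fin.getElem_fin, List.getD_eq_getElem?_getD, List.getElem?_eq_getElem j.2,
      Option.getD_some]
  have hu : xorFst (rowSupp (giRows Gb mt) a) ≠ 0 := by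
    intro h0
    have ha := ofBits_xorFst_rowSupp (giRows Gb mt) a
    rw [h0, ofBits_zero] at ha
    have hpos : 0 < hammingNorm a := ha1
    rw [hammingNorm_pos_iff] at hpos
    exact hpos ha.symm
  have hclt : xorSnd (rowSupp (giRows Gb mt) a) < 2 ^ n := by
    refine xorList_lt n _ fun x hx => ?_
    simp only [rowSupp, List.map_map, List.mem_map, Function.comp_apply] at hx
    obtain ⟨j, hj, rfl⟩ := hx
    have hjl := lt_of_mem_suppIdx _ a hj
    rw [List.getD_eq_getElem?_getD, List.getElem?_eq_getElem hjl, Option.getD_some]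
    exact hlt _ (List.getElem_mem hjl)
  simp only [Bool.or_eq_true, beq_iff_eq] at hreach
  rcases hreach with (h0 | hwt) | hmem
  · exact absurd h0 hu
  · have h1 := lt_popc_of_wtGt n wmax _ hclt hwt
    rw [← hammingNorm_ofBits, ← hsum] at h1
    omega
  · exact ⟨_, List.mem_of_elem_eq_true hmem, hsum.symm⟩

/-- **L5 with an allow LIST (no labels).** For ANY row list `Gb` on `n > 0` qubits: if the block check
`blockOK n wmax target allow Gb b` passes (type-10 `Census/CertCheckBZ.lean`: each matrix `G_i = A_i · G_b` systematic on its
information set, its depth-`t_i` replay, the recounted relative-rank bound `≥ target`), every matrix has `|G_b|` rows, and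
`wmax < target`, then every NON-ZERO vector of `rowspace Gb` of weight `≤ wmax` is a LISTED word: the allow-list is complete
for weight `≤ wmax`. (Brouwer–Zimmermann: a codeword missing every depth-`t_i` enumeration has `≥ t_i + 1` information
symbols on each `T_i`, hence weight `≥ Σ (t_i + 1 − (kb − r_i))⁺ = bound ≥ target`; type-07 `bz_enumeration_span`.) -/
theorem bz_list_sound (hn : 0 < n) {wmax target : ℕ} {allow Gb : List ℕ} {b : BZBlock}
    (hblk : blockOK n wmax target allow Gb b = true) (htw : wmax < target)
    (hlen : (b.mats.all fun mt => mt.A.length == Gb.length) = true)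
    {c : Fin n → ZMod 2} (hc : c ∈ rowSpace (rowMatrix n Gb)) (hc0 : c ≠ 0) (hw : hammingNorm c ≤ wmax) :
    ∃ w ∈ allow, ofBits n w = c := by
  simp only [blockOK, Bool.and_eq_true, List.all_eq_true, decide_eq_true_eq] at hblk
  obtain ⟨hmats, hbd⟩ := hblk
  simp only [List.all_eq_true, beq_iff_eq] at hlen
  have hmat : ∀ i : Fin b.mats.length, matrixOK n wmax allow Gb (b.mats[i]) = true :=
    fun i => hmats _ (List.getElem_mem i.2)
  have hAlen : ∀ i : Fin b.mats.length, (giRows Gb (b.mats[i])).length = Gb.length := fun i => by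
    rw [giRows, List.length_map]
    exact hlen _ (List.getElem_mem i.2)
  have hsysOK : ∀ i : Fin b.mats.length, systematicOK n (giRows Gb (b.mats[i])) (b.mats[i]).T = true := fun i => by
    have := hmat i
    simp only [matrixOK, Bool.and_eq_true] at this
    exact this.1.1
  have hTlen : ∀ i : Fin b.mats.length, (b.mats[i]).T.length = Gb.length := fun i => by
    have := hsysOK i
    simp only [systematicOK, Bool.and_eq_true, beq_iff_eq] at this
    rw [← this.1.1, hAlen i]
  have hTlt : ∀ (i : Fin b.mats.length) (q : ℕ), q ∈ (b.mats[i]).T → q < n := fun i q hq => by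
    have := hsysOK i
    simp only [systematicOK, Bool.and_eq_true, List.all_eq_true, decide_eq_true_eq] at this
    exact this.1.2 q hq
  have hcspan : c ∈ Submodule.span (ZMod 2) (Set.range fun j : Fin Gb.length => rowMatrix n Gb j) := by
    rw [← rowSpace_rowMatrix_eq_span]; exact hc
  have hbound : wmax < bzBound (fun i : Fin b.mats.length => colFun hn (b.mats[i]).T Gb.length)
      fun i => (b.mats[i]).t := by
    rw [← bzBoundList_eq_bzBound hn hTlt hTlen]; omega
  exact bz_enumeration_span (F := ZMod 2) (P := fun v => ∃ w ∈ allow, ofBits n w = v)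
    (Gb := fun j : Fin Gb.length => rowMatrix n Gb j)
    (G := fun i => rowFun n (giRows Gb (b.mats[i])) Gb.length)
    (T := fun i => colFun hn (b.mats[i]).T Gb.length)
    (fun i j j' => hsys_of_systematicOK hn (hsysOK i) (hTlen i) j j')
    (fun i j => by rw [← rowSpace_rowMatrix_eq_span]; exact rowFun_giRows_mem Gb _ _ j)
    (t := fun i => (b.mats[i]).t) (wmax := wmax)
    (fun i a ha1 hat haw => henum_list_of_matrixOK (hmat i) (hAlen i) a ha1 hat haw)
    hbound hcspan hc0 hw

/-- The same with the conclusion as list membership of a canonical word: if moreover every listed word is `< 2^n`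
and `c = ofBits n v` with `v < 2^n`, then `v ∈ allow`. -/
theorem mem_allow_of_bz_list (hn : 0 < n) {wmax target : ℕ} {allow Gb : List ℕ} {b : BZBlock}
    (hblk : blockOK n wmax target allow Gb b = true) (htw : wmax < target)
    (hlen : (b.mats.all fun mt => mt.A.length == Gb.length) = true)
    (hallow : ∀ w ∈ allow, w < 2 ^ n) {v : ℕ} (hv : v < 2 ^ n)
    (hc : ofBits n v ∈ rowSpace (rowMatrix n Gb)) (hc0 : ofBits n v ≠ 0) (hw : hammingNorm (ofBits n v) ≤ wmax) :
    v ∈ allow := by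
  obtain ⟨w, hwm, hwe⟩ := bz_list_sound hn hblk htw hlen hc hc0 hw
  have : w = v := ofBits_inj (hallow w hwm) hv hwe
  subst this
  exact hwm

end List

/-! ## Control: the seven weight-3 words of the `[7,4]` Hamming code, tier KERNEL -/

/-- A systematic generator matrix of the `[7,4,3]` Hamming code (rows as words, bit `j` = coordinate `j`; information
set `{0,1,2,3}`): rows `{0,4,5}, {1,4,6}, {2,5,6}, {3,4,5,6}`. DATA for the control. -/
def hammingGb : List ℕ := [0b0110001, 0b1010010, 0b1100100, 0b1111000]

/-- The seven weight-3 codewords of the Hamming code (the allow-list to be proven complete). -/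
def hammingW3 : List ℕ := [0b0110001, 0b1010010, 0b1100100, 0b0000111, 0b0011100, 0b0101010, 0b1001001]

/-- The block: one matrix, identity selection (`A = unit words`), information set `[0,1,2,3]`, depth `3`. -/
def hammingBlock : BZBlock := ⟨[], [{ T := [0, 1, 2, 3], A := [1, 2, 4, 8], t := 3 }]⟩

/-- The block check passes with `wmax = 3`, `target = 4`. -/
theorem hamming_blockOK : blockOK 7 3 4 hammingW3 hammingGb hammingBlock = true := by decide

/-- Hence every non-zero Hamming codeword of weight `≤ 3` is one of the seven listed words (KERNEL). -/
theorem hamming_weight3_complete {c : Fin 7 → ZMod 2} (hc : c ∈ rowSpace (rowMatrix 7 hammingGb)) (hc0 : c ≠ 0)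
    (hw : hammingNorm c ≤ 3) : ∃ w ∈ hammingW3, ofBits 7 w = c :=
  bz_list_sound (by decide) hamming_blockOK (by decide) (by decide) hc hc0 hw


/-! ## The block verdict from its STRUCTURAL part and external `Reaches` facts (appended 2026-08-27)

For lists beyond one `decide` (e.g. the level-2 list of the `[[288,12,18]]` cover certificate: three matrices,
`≈ 1.2·10⁷` selections) the enumeration is replayed by a lane engine — type-01's `Plane.reaches_of_segList`
(CertBZPlaneSound), chunk by chunk — and delivered as `Reaches (bzLeaf wmax allow) (rowPos (giRows Gb mt) 0) mt.t 0 0`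
per matrix; the cheap structural conjuncts stay a `decide`. `blockOK_of_struct_reaches` recombines them into the
verdict `bz_list_sound` / `mem_allow_of_bz_list` consume (plus their `hlen`). -/

/-- Converse of `scan_sublist` (private copy of type-01's `CertBZChunks.scan_of_reaches`, kept local so that this
module's import closure — hence its append-only constant set — is unchanged). -/
private theorem scan_of_reaches' (test : ℕ → ℕ → Bool) :
    ∀ (L : List (ℕ × ℕ)) (b v s : ℕ), Reaches test L b v s → scan test L b v s = true := by
  intro L
  induction L with
  | nil =>
    intro b v s h
    have h0 := h [] (List.nil_sublist _) (Nat.zero_le _)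
    simpa [scan, xorFst, xorSnd, xorList] using h0
  | cons a L ih =>
    intro b v s h
    cases b with
    | zero =>
      have h0 := h [] (List.nil_sublist _) (le_refl 0)
      simpa [scan, xorFst, xorSnd, xorList] using h0
    | succ b =>
      obtain ⟨p, c⟩ := a
      simp only [scan, Bool.and_eq_true]
      refine ⟨ih (b + 1) v s fun S hS hlen => h S (hS.cons _) hlen, ih b (v ^^^ p) (s ^^^ c) fun S hS hlen => ?_⟩
      have h1 := h ((p, c) :: S) (hS.cons_cons _) (by simpa using hlen)
      rw [xorFst_cons, xorSnd_cons] at h1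
      simpa [Nat.xor_assoc] using h1

/-- Structural part of `matrixOK` (systematic form on `T`, rows below `2^n`) — everything but the replay. (definition) -/
def matrixStructOK (n : ℕ) (Gb : List ℕ) (mt : BZMatrix) : Bool :=
  systematicOK n (giRows Gb mt) mt.T && ((giRows Gb mt).all fun g => decide (g < 2 ^ n))

/-- Structural part of `blockOK` together with the `A`-length condition of `bz_list_sound`: per matrix
`matrixStructOK` and `|A| = |Gb|`, and the recounted Brouwer–Zimmermann bound reaches `target`. (definition) -/
def blockStructOK (n target : ℕ) (Gb : List ℕ) (b : BZBlock) : Bool :=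
  (b.mats.all fun mt => matrixStructOK n Gb mt && (mt.A.length == Gb.length)) &&
    decide (target ≤ bzBoundList n Gb.length b.mats 0)

/-- `matrixOK` from its structural part and a `Reaches` fact for the replay (however obtained). -/
theorem matrixOK_of_struct_reaches {n wmax : ℕ} {allow Gb : List ℕ} {mt : BZMatrix}
    (hs : matrixStructOK n Gb mt = true) (hr : Reaches (bzLeaf wmax allow) (rowPos (giRows Gb mt) 0) mt.t 0 0) :
    matrixOK n wmax allow Gb mt = true := by
  simp only [matrixStructOK, Bool.and_eq_true] at hs
  simp only [matrixOK, Bool.and_eq_true]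
  exact ⟨hs, scan_of_reaches' _ _ _ _ _ hr⟩

/-- **`blockOK` (and `hlen`) from the structural verdict and one `Reaches` fact per matrix.** -/
theorem blockOK_of_struct_reaches {n wmax target : ℕ} {allow Gb : List ℕ} {b : BZBlock}
    (hs : blockStructOK n target Gb b = true)
    (hr : ∀ (i : ℕ) (hi : i < b.mats.length),
      Reaches (bzLeaf wmax allow) (rowPos (giRows Gb b.mats[i]) 0) (b.mats[i]).t 0 0) :
    blockOK n wmax target allow Gb b = true ∧ (b.mats.all fun mt => mt.A.length == Gb.length) = true := by
  simp only [blockStructOK, Bool.and_eq_true, List.all_eq_true, decide_eq_true_eq] at hs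
  obtain ⟨hm, hbd⟩ := hs
  refine ⟨?_, ?_⟩
  · simp only [blockOK, Bool.and_eq_true, List.all_eq_true, decide_eq_true_eq]
    refine ⟨fun mt hmt => ?_, hbd⟩
    obtain ⟨i, hi, rfl⟩ := List.getElem_of_mem hmt
    exact matrixOK_of_struct_reaches (hm _ hmt).1 (hr i hi)
  · simp only [List.all_eq_true]
    exact fun mt hmt => (hm mt hmt).2

/-- **List completeness from structure + `Reaches`**, word form: every `v < 2^n` with `ofBits n v` a non-zero
vector of `rowspace Gb` of weight `≤ wmax` is LISTED. -/
theorem mem_allow_of_struct_reaches {n : ℕ} (hn : 0 < n) {wmax target : ℕ} {allow Gb : List ℕ} {b : BZBlock}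
    (hs : blockStructOK n target Gb b = true)
    (hr : ∀ (i : ℕ) (hi : i < b.mats.length),
      Reaches (bzLeaf wmax allow) (rowPos (giRows Gb b.mats[i]) 0) (b.mats[i]).t 0 0)
    (htw : wmax < target) (hallow : ∀ w ∈ allow, w < 2 ^ n) {v : ℕ} (hv : v < 2 ^ n)
    (hc : ofBits n v ∈ rowSpace (rowMatrix n Gb)) (hc0 : v ≠ 0) (hw : popc n v ≤ wmax) : v ∈ allow := by
  obtain ⟨hblk, hlen⟩ := blockOK_of_struct_reaches hs hr
  exact mem_allow_of_bz_list hn hblk htw hlen hallow hv hc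
    (fun h => hc0 (ofBits_inj hv (Nat.two_pow_pos _) (h.trans (ofBits_zero _).symm))) (by rwa [hammingNorm_ofBits])

/-- Depth `0`: only the empty selection, at which `bzLeaf` holds (`u = 0`) — no engine needed. -/
theorem reaches_depth_zero (wmax : ℕ) (allow : List ℕ) (L : List (ℕ × ℕ)) :
    Reaches (bzLeaf wmax allow) L 0 0 0 := by
  intro S _ hlen
  rw [List.length_eq_zero_iff.1 (Nat.le_zero.1 hlen)]
  simp [xorFst, xorSnd, xorList, bzLeaf]

end Summit.Ventures.QEC.Census
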